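import Summits.ResolutionOfSingularities.ResolutionOfSingularities.Theorems.HilbertSamuelEliminationSigmaMaxModificationsCorridor3StratumPushforward
import Literature.AlgebraicGeometry.Resolution.SurfaceResolutionPermissibleCentres
import Literature.AlgebraicGeometry.Resolution.BlowupSequencesAppend
import Literature.AlgebraicGeometry.Resolution.BlowupSmoothProjective
import HarnessLib

/-!
# Route `HilbertSamuelElimination`, crux `SigmaMaxModificationsCorridor3`
# (stmt-ResolutionOfSingularities-19249; child of `SigmaMaxModifications` stmt-…-18506),
# line `tame_wild` v3 — ONE CONFINEMENT ROUND: resolve a stratum surface inside `Y`, then blow it up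

[OURS · L1 W4.2] Assembly of one round of the rung FC-R1 (card `fibral-confinement`; CHAIN w42 §4
row stub-3) / of the confinement stub `stub_confine3` of skeleton v3, from the landed bricks
p478970 (`…RegularCentresPermissible`) and p479795 (`…StratumPushforward`) and the printed
Cossart–Jannsen–Saito Thm. 1.2 WITH PERMISSIBLE CENTRES (tree named fact
`CossartJannsenSaito2020SequencePermissible`, taken as a hypothesis `hCJS`).

Bookkeeping lemmas (all PROVED):
* `CentreSeq.AllPermissible.allRegular` — permissible centres are regular (CJS Def. 3.1 (2)).
* `isRegular_subscheme_bot` — `V(0) = X` is a regular closed subscheme of a regular `X` (the image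
  of a closed immersion with regular source is the tree's `isRegular_ker_subscheme`).
* `mem_regularLocus_of_maximalIdeal_mem_minimalPrimes` — maximal points of a reduced scheme are
  regular; `CentreSeq.centresOver_compl_maximal_of_centresInSingularLocus` — hence a sequence with
  centres in the singular loci of its stages (CJS Thm. 1.2) has centres over the non-maximal points.
* `CentreSeq.CentresOver.pushforward_image` — `τ_* t` has centres over `τ(T)` if `t` has centres
  over `T` (Kollár 3.30.3).
* `CentreSeq.centresInStratum_append_iff` — `CentresInStratum` along a concatenation.
* `IsBlowup.existsUnique_preimage_of_not_mem_support`,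
  `CentreSeq.existsUnique_preimage_of_centresOver` (+ `isIso_stalkMap`) — over a point off (the
  images of) the centres a blow-up (sequence) has exactly one point, with isomorphic local ring
  (Stacks 02OS).
* `stalkIdeal_ker_eq_maximalIdeal_of_isField` — at the image of a maximal point of a reduced `S`,
  the kernel ideal sheaf of a closed immersion `S ↪ X` has the maximal ideal as its stalk.

Main theorem `exists_centreSeq_round`: for `Y` reduced, locally of finite type and quasi-compact
over a field `k`, `dim Y ≤ N`, `ν ∈ Σ_Y(N)^max`, `ν ≠ Φ^{(N)}`, and a
closed immersion `τ : S ↪ Y` of a reduced `S` of dimension `≤ 2` into `Y(ν)`: there are a blow-up sequence `s₁` of `Y` and a centre `D` on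
its last scheme such that `s₁ ⧺ [D]` has REGULAR centres INSIDE the successive `ν`-strata (hence is
permissible, `H^N`-monotone, with centres over `Y(ν)` — p478970), `V(D)` is regular, and over every
maximal point `s` of `S` the composite of `s₁` is a local isomorphism at the unique point `y₁` over
`τ s`, which lies on `V(D)` with `D_{y₁} = 𝔪_{y₁}` — so that the last blow-up is, locally over
`τ s`, the blow-up of the closed point of `Spec 𝒪_{Y,τ s}` (the input of the termination analysis at the
codimension-one points, next file). Construction: `t` = the CJS resolution of the surface `S`
(`hCJS`), `s₁ = τ_* t` (p479795), `D = ker j_r` the image of the regular `S_r`.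

NOT a statement of any manuscript; AI-written, weaker than expert review.

## Sources

* V. Cossart, U. Jannsen, S. Saito, *Desingularization: Invariants and Strategy*, LNM 2270
  (2020), Thm. 1.2, Def. 3.1, Thm. 3.3, Thm. 3.10 (1), Lemma 3.15 (1), Def. 6.14, Rem. 6.29 (1).
  [CossartJannsenSaito2020]
* J. Kollár, *Lectures on Resolution of Singularities* (2007), 3.30.3. [Kollar2007]
* The Stacks Project, Tags 01J7, 02OS. [StacksProject]
-/

set_option linter.dupNamespace false -- mandated namespace of this single-conjunct summit

noncomputable section

open CategoryTheory AlgebraicGeometry TopologicalSpace Topology IsLocalRing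
open Literature.AlgebraicGeometry.Resolution Literature.RingTheory.HilbertSamuel

namespace Summit.ResolutionOfSingularities.ResolutionOfSingularities.Theorems.SigmaMaxModificationsCorridor3.Helpers

universe u

/-! ## Permissible centres are regular -/

/-- **Permissible centres are regular** (CJS Def. 3.1 (2): "`D` is regular …"): along a blow-up
sequence, `AllPermissible → AllRegular`. [cite: CossartJannsenSaito2020, Def. 3.1 (2)] -/
theorem CentreSeq.AllPermissible.allRegular :
    ∀ {X : Scheme.{u}} [IsLocallyNoetherian X] {s : CentreSeq X}, s.AllPermissible → s.AllRegular
  | _, _, CentreSeq.nil _, _ => trivial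
  | X, _, CentreSeq.cons C rest, h => by
    haveI : IsProper (blowup.π C) := (blowup.isBlowup C).isProper
    haveI : IsLocallyNoetherian (blowup C) := LocallyOfFiniteType.isLocallyNoetherian (blowup.π C)
    exact (CentreSeq.allRegular_cons C rest).mpr
      ⟨Scheme.isRegular_subscheme_of_forall C fun x hx => (h.1 x hx).isRegularLocalRing,
        CentreSeq.AllPermissible.allRegular h.2⟩

/-! ## Regular closed subschemes: `V(0)` and images of closed immersions -/

/-- `V(0) = X` is a regular closed subscheme of a regular `X`. [folklore] -/
theorem isRegular_subscheme_bot {X : Scheme.{u}} (hX : Scheme.IsRegular X) :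
    Scheme.IsRegular (⊥ : X.IdealSheafData).subscheme := fun x => by
  haveI := hX ((Scheme.IdealSheafData.subschemeι ⊥).base x)
  exact IsRegularLocalRing.of_ringEquiv
    (asIso ((Scheme.IdealSheafData.subschemeι (⊥ : X.IdealSheafData)).stalkMap x)).commRingCatIsoToRingEquiv

/-- The support of `ker j` is the range of the closed immersion `j`. [folklore] -/
theorem coe_support_ker_of_isClosedImmersion {S X : Scheme.{u}} (j : S ⟶ X) [IsClosedImmersion j] :
    ((j.ker.support : Closeds X) : Set X) = Set.range j.base := by
  rw [Scheme.Hom.support_ker, j.isClosedEmbedding.isClosed_range.closure_eq]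

/-! ## Maximal points of a reduced scheme -/

/-- **Maximal points of a reduced scheme are regular**: if `𝔪_x` is a minimal prime of the reduced
local ring `𝒪_{X,x}`, then `𝒪_{X,x}` is a field. [folklore] -/
theorem mem_regularLocus_of_maximalIdeal_mem_minimalPrimes {X : Scheme.{u}} [IsReduced X] {x : X}
    (hx : maximalIdeal (X.presheaf.stalk x) ∈ minimalPrimes (X.presheaf.stalk x)) :
    x ∈ Scheme.regularLocus X := by
  have hF : IsField (X.presheaf.stalk x) :=
    (IsLocalRing.isField_iff_maximalIdeal_eq).mpr (maximalIdeal_eq_bot_of_mem_minimalPrimes hx)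
  letI := hF.toField
  show IsRegularLocalRing (X.presheaf.stalk x)
  infer_instance

/-- Along an isomorphism of local rings `𝒪_{X,x} ≅ 𝒪_{X',x'}` of REDUCED stalks, maximality of
the point is preserved: if `𝔪_x` is a minimal prime then so is `𝔪_{x'}`. [folklore] -/
theorem maximalIdeal_mem_minimalPrimes_of_ringEquiv {R R' : Type*} [CommRing R] [CommRing R']
    [IsLocalRing R] [IsLocalRing R'] [IsReduced R] (e : R ≃+* R')
    (h : maximalIdeal R ∈ minimalPrimes R) : maximalIdeal R' ∈ minimalPrimes R' := by
  have hF : IsField R :=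
    (IsLocalRing.isField_iff_maximalIdeal_eq).mpr (maximalIdeal_eq_bot_of_mem_minimalPrimes h)
  have hF' : IsField R' := MulEquiv.isField hF e.symm.toMulEquiv
  letI := hF'.toField
  rw [(IsLocalRing.isField_iff_maximalIdeal_eq).mp hF', IsDomain.minimalPrimes_eq_singleton_bot]
  rfl

/-- **Centres in the singular loci lie over the non-maximal points** (for a REDUCED `S`): a blow-up
sequence `t` of `S` with `D_i ⊆ (S_i)_sing` for all `i` (CJS Thm. 1.2) has all its centres over
`{s ∈ S | 𝔪_s ∉ minimalPrimes 𝒪_{S,s}}`. Indeed a maximal point is regular, so not in `D_0`; the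
blow-up is an isomorphism near the points over it, which are therefore again maximal points of
`S_1`, and so on. [cite: CossartJannsenSaito2020, Thm. 1.2 (p. 5)] [cite: StacksProject, Tag 02OS] -/
theorem CentreSeq.centresOver_compl_maximal_of_centresInSingularLocus :
    ∀ {S : Scheme.{u}} [IsLocallyNoetherian S] [IsReduced S] (t : CentreSeq S),
      t.CentresInSingularLocus →
        t.CentresOver {s : S | maximalIdeal (S.presheaf.stalk s) ∉ minimalPrimes (S.presheaf.stalk s)}
  | _, _, _, CentreSeq.nil _, _ => trivial
  | S, _, _, CentreSeq.cons C rest, h => by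
    obtain ⟨hC, hrest⟩ := (CentreSeq.centresInSingularLocus_cons C rest).mp h
    haveI : IsProper (blowup.π C) := (blowup.isBlowup C).isProper
    haveI : IsLocallyNoetherian (blowup C) := LocallyOfFiniteType.isLocallyNoetherian (blowup.π C)
    haveI : IsReduced (blowup C) := (blowup.isBlowup C).isReduced_of_isReduced
    refine (CentreSeq.centresOver_cons C rest _).mpr ⟨fun s hs hmax => hC hs
      (mem_regularLocus_of_maximalIdeal_mem_minimalPrimes hmax), CentreSeq.CentresOver.mono rest ?_
      (CentreSeq.centresOver_compl_maximal_of_centresInSingularLocus rest hrest)⟩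
    -- a point of `Bl_C S` over a maximal point of `S` is a maximal point of `Bl_C S`
    intro s₁ hs₁ hmax
    apply hs₁
    have hsC : (blowup.π C).base s₁ ∉ (C.support : Set S) := fun h' =>
      hC h' (mem_regularLocus_of_maximalIdeal_mem_minimalPrimes hmax)
    have hE : s₁ ∉ (C.comap (blowup.π C)).support := by
      rw [Scheme.IdealSheafData.support_comap]; exact hsC
    haveI : IsIso ((blowup.π C).stalkMap s₁) :=
      (blowup.isBlowup C).isIso_stalkMap_of_not_mem_exceptional hE
    exact maximalIdeal_mem_minimalPrimes_of_ringEquiv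
      (asIso ((blowup.π C).stalkMap s₁)).commRingCatIsoToRingEquiv hmax

/-! ## Centres over a set, along a push-forward and a concatenation -/

/-- **`τ_* t` has centres over `τ(T)` if `t` has centres over `T`** (the centres of the
push-forward are the images `τ_i(Z_i)` of those of `t`, Kollár 3.30.3). [cite: Kollar2007, 3.30.3] -/
theorem CentreSeq.CentresOver.pushforward_image :
    ∀ {S X : Scheme.{u}} (t : CentreSeq S) (τ : S ⟶ X) [IsClosedImmersion τ] (T : Set S),
      t.CentresOver T → (t.pushforward τ).CentresOver (τ.base '' T)
  | _, _, CentreSeq.nil _, _, _, _, _ => trivial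
  | S, X, CentreSeq.cons C' rest, τ, _, T, h => by
    obtain ⟨hC', hrest⟩ := (CentreSeq.centresOver_cons C' rest T).mp h
    refine (CentreSeq.centresOver_cons _ _ _).mpr ⟨?_, CentreSeq.CentresOver.mono _ ?_
      (CentreSeq.CentresOver.pushforward_image rest (blowup.pushforwardMap C' τ) _ hrest)⟩
    · rw [coe_support_map_of_isClosedImmersion]
      exact Set.image_mono hC'
    · rintro _ ⟨s₁, hs₁, rfl⟩
      show (blowup.π (C'.map τ)).base ((blowup.pushforwardMap C' τ).base s₁) ∈ τ.base '' T
      have hc := Scheme.Hom.comp_apply (blowup.pushforwardMap C' τ) (blowup.π (C'.map τ)) s₁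
      rw [blowup.pushforwardMap_π, Scheme.Hom.comp_apply] at hc
      rw [← hc]
      exact ⟨_, hs₁, rfl⟩

/-- `CentresInStratum` along a concatenation: both parts have centres in the strata of their own
stages. [cite: CossartJannsenSaito2020, Def. 6.14] -/
theorem CentreSeq.centresInStratum_append_iff {N : ℕ} {ν : ℕ → ℕ} :
    ∀ {X : Scheme.{u}} (s : CentreSeq X) (t : CentreSeq s.top),
      (s.append t).CentresInStratum N ν ↔ s.CentresInStratum N ν ∧ t.CentresInStratum N ν
  | _, CentreSeq.nil _, _ => ⟨fun h => ⟨trivial, h⟩, fun h => h.2⟩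
  | _, CentreSeq.cons C rest, t => by
    dsimp only [CentreSeq.top_cons] at t ⊢
    rw [CentreSeq.cons_append, CentreSeq.centresInStratum_cons, CentreSeq.centresInStratum_cons,
      CentreSeq.centresInStratum_append_iff rest t, and_assoc]

/-! ## Over a point off the centres: one point upstairs, isomorphic local ring -/

/-- **Over a point off the centre a blow-up has exactly one point** (the blow-up is an
isomorphism over the complement of the centre, Stacks 02OS). [cite: StacksProject, Tag 02OS] -/
theorem IsBlowup.existsUnique_preimage_of_not_mem_support {X X' : Scheme.{u}} {π : X' ⟶ X}
    {C : X.IdealSheafData} (hπ : IsBlowup π C) {x : X} (hx : x ∉ (C.support : Set X)) :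
    ∃! x' : X', π.base x' = x := by
  set U : X.Opens := ⟨(C.support : Set X)ᶜ, C.support.isClosed.isOpen_compl⟩ with hU
  haveI : IsIso (π ∣_ U) := hπ.isIso_compl
  have hbij : Function.Bijective (π ∣_ U).base :=
    ConcreteCategory.bijective_of_isIso (π ∣_ U).base
  obtain ⟨⟨x', hx'U⟩, hx'⟩ := hbij.2 ⟨x, hx⟩
  have hx'x : π.base x' = x := by
    have h := congrArg Subtype.val hx'
    rw [morphismRestrict_base_coe] at h
    exact h
  refine ⟨x', hx'x, fun x'' hx'' => ?_⟩
  have hx''U : x'' ∈ π ⁻¹ᵁ U := by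
    show π.base x'' ∈ (C.support : Set X)ᶜ
    rw [hx'']; exact hx
  have h1 : (π ∣_ U).base ⟨x'', hx''U⟩ = ⟨x, hx⟩ := by
    apply Subtype.ext
    rw [morphismRestrict_base_coe]
    exact hx''
  have h2 := hbij.1 (h1.trans hx'.symm)
  exact congrArg Subtype.val h2

/-- **Along a blow-up sequence with centres over `T`, a point `y ∉ T` has exactly one point over
it, at which the composite induces an isomorphism of local rings.**
[cite: StacksProject, Tag 02OS] -/
theorem CentreSeq.existsUnique_preimage_of_centresOver :
    ∀ {Y : Scheme.{u}} (s : CentreSeq Y) (T : Set Y), s.CentresOver T → ∀ {y : Y}, y ∉ T →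
      (∃! y' : s.top, s.comp.base y' = y) ∧
        ∀ y' : s.top, s.comp.base y' = y → IsIso (s.comp.stalkMap y')
  | Y, CentreSeq.nil _, _, _, y, _ => by
    refine ⟨⟨y, rfl, fun y' hy' => hy'⟩, fun y' _ => ?_⟩
    show IsIso ((𝟙 Y : Y ⟶ Y).stalkMap y')
    infer_instance
  | Y, CentreSeq.cons C rest, T, h, y, hy => by
    obtain ⟨hC, hrest⟩ := (CentreSeq.centresOver_cons C rest T).mp h
    have hyC : y ∉ (C.support : Set Y) := fun h' => hy (hC h')
    obtain ⟨y₁, hy₁, huniq⟩ := IsBlowup.existsUnique_preimage_of_not_mem_support (blowup.isBlowup C) hyC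
    have hy₁T : y₁ ∉ (blowup.π C) ⁻¹' T := by
      show (blowup.π C).base y₁ ∉ T
      rw [hy₁]; exact hy
    obtain ⟨⟨y', hy', huniq'⟩, hiso⟩ :=
      CentreSeq.existsUnique_preimage_of_centresOver rest _ hrest hy₁T
    have hover : ∀ y'' : rest.top, (rest.comp ≫ blowup.π C).base y'' = y →
        rest.comp.base y'' = y₁ := fun y'' hy'' =>
      huniq _ (show (blowup.π C).base (rest.comp.base y'') = y by
        rw [← Scheme.Hom.comp_apply]; exact hy'')
    refine ⟨⟨y', ?_, fun y'' hy'' => huniq' y'' (hover y'' hy'')⟩, fun y'' hy'' => ?_⟩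
    · show (rest.comp ≫ blowup.π C).base y' = y
      rw [Scheme.Hom.comp_apply]
      show (blowup.π C).base (rest.comp.base y') = y
      rw [hy', hy₁]
    · have h1 : IsIso (rest.comp.stalkMap y'') := hiso y'' (hover y'' hy'')
      have hE : rest.comp.base y'' ∉ (C.comap (blowup.π C)).support := by
        rw [Scheme.IdealSheafData.support_comap, hover y'' hy'']
        show (blowup.π C).base y₁ ∉ (C.support : Set Y)
        rw [hy₁]; exact hyC
      have h2 : IsIso ((blowup.π C).stalkMap (rest.comp.base y'')) :=
        (blowup.isBlowup C).isIso_stalkMap_of_not_mem_exceptional hE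
      show IsIso ((rest.comp ≫ blowup.π C).stalkMap y'')
      rw [Scheme.Hom.stalkMap_comp]
      exact @IsIso.comp_isIso _ _ _ _ _ _ _ h2 h1

/-! ## The kernel of a closed immersion at the image of a maximal point -/

/-- At the image of a point `s` whose local ring `𝒪_{S,s}` is a field (a maximal point of a
reduced `S`), the kernel ideal sheaf of a closed immersion `j : S ↪ X` has stalk the maximal ideal:
`(ker j)_{j s} = 𝔪_{j s}` (the quotient `𝒪_{X,j s}/(ker j)_{j s} ≅ 𝒪_{S,s}` is a field).
[folklore] -/
theorem stalkIdeal_ker_eq_maximalIdeal_of_isField {S X : Scheme.{u}} (j : S ⟶ X)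
    [IsClosedImmersion j] {s : S} (hs : IsField (S.presheaf.stalk s)) :
    stalkIdeal j.ker (j.base s) = maximalIdeal (X.presheaf.stalk (j.base s)) := by
  rw [← ker_stalkMap_of_isClosedImmersion j s]
  have hsurj : Function.Surjective (j.stalkMap s).hom := j.stalkMap_surjective s
  haveI : (RingHom.ker (j.stalkMap s).hom).IsMaximal :=
    Ideal.Quotient.maximal_of_isField _
      (MulEquiv.isField hs (RingHom.quotientKerEquivOfSurjective hsurj).toMulEquiv)
  exact IsLocalRing.eq_maximalIdeal inferInstance

/-! ## One confinement round -/

/-- **One confinement round: resolve a stratum surface inside `Y`, then blow it up.** Let `Y` be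
reduced, locally of finite type and quasi-compact over a field `k`, `dim Y ≤ N`, `ν ∈ Σ_Y(N)^max`
with `ν ≠ Φ^{(N)}`, and let `τ : S ↪ Y` be a closed immersion of a REDUCED scheme of dimension
`≤ 2` into the stratum `Y(ν)` (e.g. the union of the two-dimensional components of `Y(ν)` with its
reduced structure). Assume CJS Thm. 1.2 with permissible centres (`hCJS`, tree named fact
`CossartJannsenSaito2020SequencePermissible`). Then there are a blow-up sequence `s₁` of `Y` and a
centre `D` on its last scheme `Y_r` such that:
* `s₁ ⧺ [D]` has REGULAR centres lying in the successive `ν`-strata (so it is permissible, `H^N`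
  does not increase along it, and its centres lie over `Y(ν)`: p478970
  `CentreSeq.confinementClauses_of_allRegular_of_centresInStratum`);
* `V(D)` is regular and contained in `Y_r(ν)`;
* over every maximal point `s` of `S` (a point with `𝒪_{S,s}` zero-dimensional, i.e. the generic
  point of a component of `S`): `Y_r → Y` has exactly ONE point `y₁` over `τ s`, the local rings
  `𝒪_{Y,τ s} ≅ 𝒪_{Y_r,y₁}` are identified, `y₁ ∈ V(D)` and `D_{y₁} = 𝔪_{y₁}` — so that over
  `τ s` the last blow-up is the blow-up of the closed point of `Spec 𝒪_{Y,τ s}`.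
Construction (CJS Rem. 6.29 (1) in dimension three, first move): `t` = the CJS resolution of `S`
(permissible centres in the singular loci, regular last scheme `S_r`), `s₁ = τ_* t` its Kollár
push-forward (p479795: regular centres in the strata, `j_r(S_r) ⊆ Y_r(ν)`), `D = ker j_r` the
image of `S_r`; the centres of `t` avoid the maximal points of `S` (they lie in the singular loci,
and `S` is reduced), so `Y_r → Y` is a local isomorphism over `τ s`.
[cite: CossartJannsenSaito2020, Thm. 1.2, Rem. 6.29 (1), Lemma 3.15 (1), Thm. 3.10 (1)]
[cite: Kollar2007, 3.30.3] [cite: StacksProject, Tag 02OS] -/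
theorem exists_centreSeq_round (hCJS : CossartJannsenSaito2020SequencePermissible.{u})
    {k : Type u} [Field k] {Y : Scheme.{u}} (g : Y ⟶ Spec (.of k)) [LocallyOfFiniteType g]
    [QuasiCompact g] [IsReduced Y] {N : ℕ} (hdim : topologicalKrullDim Y ≤ (N : WithBot ℕ∞))
    {ν : ℕ → ℕ} (hν : ν ≠ iterPSum N Phi) (hmax : Maximal (· ∈ Scheme.hsValues Y N) ν)
    {S : Scheme.{u}} (τ : S ⟶ Y) [IsClosedImmersion τ] [IsReduced S]
    (hS2 : topologicalKrullDim S ≤ 2) (hτ : Set.range τ.base ⊆ Scheme.hsStratum Y N ν) :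
    ∃ (s₁ : CentreSeq Y) (D : s₁.top.IdealSheafData),
      (s₁.append (CentreSeq.single D)).AllRegular ∧
      (s₁.append (CentreSeq.single D)).CentresInStratum N ν ∧
      Scheme.IsRegular D.subscheme ∧
      (D.support : Set s₁.top) ⊆ Scheme.hsStratum s₁.top N ν ∧
      ∀ s : S, maximalIdeal (S.presheaf.stalk s) ∈ minimalPrimes (S.presheaf.stalk s) →
        ∃ y₁ : s₁.top, s₁.comp.base y₁ = τ.base s ∧
          (∀ y' : s₁.top, s₁.comp.base y' = τ.base s → y' = y₁) ∧
          IsIso (s₁.comp.stalkMap y₁) ∧ y₁ ∈ (D.support : Set s₁.top) ∧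
          stalkIdeal D y₁ = maximalIdeal (s₁.top.presheaf.stalk y₁) := by
  -- Noetherianity and excellence
  haveI : IsLocallyNoetherian Y := LocallyOfFiniteType.isLocallyNoetherian g
  haveI : IsLocallyNoetherian S := LocallyOfFiniteType.isLocallyNoetherian (τ ≫ g)
  haveI : CompactSpace Y := QuasiCompact.compactSpace_of_compactSpace g
  haveI : CompactSpace S := QuasiCompact.compactSpace_of_compactSpace (τ ≫ g)
  haveI : IsNoetherian S := {}
  have hexcS : Scheme.IsExcellent S :=
    Scheme.isExcellent_of_locallyOfFiniteType Stacks07QW_field_holds (τ ≫ g)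
  have hup : ∀ μ ∈ Scheme.hsValues Y N, ν ≤ μ → μ ≤ ν := fun μ hμ hle => hmax.2 hμ hle
  -- the CJS resolution of the surface `S`
  obtain ⟨t, hperm, hsing, htop⟩ := hCJS S hexcS hS2
  have hregt : t.AllRegular := CentreSeq.AllPermissible.allRegular hperm
  -- its push-forward (p479795)
  obtain ⟨hreg₁, hstr₁, hrange⟩ :=
    CentreSeq.pushforward_allRegular_centresInStratum_range hν t τ g hdim hup hτ hregt
  haveI : IsClosedImmersion (t.pushforwardι τ) := CentreSeq.isClosedImmersion_pushforwardι t τ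
  -- the last centre: the image of the regular `S_r`
  refine ⟨t.pushforward τ, (t.pushforwardι τ).ker, ?_, ?_, isRegular_ker_subscheme _ htop, ?_, ?_⟩
  · rw [CentreSeq.allRegular_append_iff]
    exact ⟨hreg₁, (CentreSeq.allRegular_cons _ _).mpr ⟨isRegular_ker_subscheme _ htop, trivial⟩⟩
  · rw [CentreSeq.centresInStratum_append_iff]
    refine ⟨hstr₁, (CentreSeq.centresInStratum_cons _ _).mpr ⟨?_, trivial⟩⟩
    rw [coe_support_ker_of_isClosedImmersion]
    exact hrange
  · rw [coe_support_ker_of_isClosedImmersion]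
    exact hrange
  · intro s hs
    -- the centres of `t` avoid the maximal points of `S`; those of `τ_* t` avoid their images
    have hovert := CentreSeq.centresOver_compl_maximal_of_centresInSingularLocus t hsing
    have hover₁ := CentreSeq.CentresOver.pushforward_image t τ _ hovert
    have hsT : s ∉ {s' : S | maximalIdeal (S.presheaf.stalk s') ∉
        minimalPrimes (S.presheaf.stalk s')} := fun h => h hs
    have hτsT : τ.base s ∉ τ.base '' {s' : S | maximalIdeal (S.presheaf.stalk s') ∉
        minimalPrimes (S.presheaf.stalk s')} := by
      rintro ⟨s', hs', he⟩
      rw [τ.isClosedEmbedding.injective he] at hs'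
      exact hs' hs
    obtain ⟨⟨y₁, hy₁, huniq⟩, hiso⟩ :=
      CentreSeq.existsUnique_preimage_of_centresOver (t.pushforward τ) _ hover₁ hτsT
    obtain ⟨⟨sr, hsr, -⟩, hisot⟩ := CentreSeq.existsUnique_preimage_of_centresOver t _ hovert hsT
    -- `j_r sr` lies over `τ s`, hence is `y₁`
    have hjsr : (t.pushforward τ).comp.base ((t.pushforwardι τ).base sr) = τ.base s := by
      rw [← Scheme.Hom.comp_apply, ← CentreSeq.pushforward_comp_ι, Scheme.Hom.comp_apply]
      show τ.base (t.comp.base sr) = τ.base s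
      rw [hsr]
    have hy₁eq : (t.pushforwardι τ).base sr = y₁ := huniq _ hjsr
    refine ⟨y₁, hy₁, huniq, hiso y₁ hy₁, ?_, ?_⟩
    · rw [coe_support_ker_of_isClosedImmersion, ← hy₁eq]
      exact ⟨sr, rfl⟩
    · -- `𝒪_{S_r,sr} ≅ 𝒪_{S,s}` is a field
      have hFs : IsField (S.presheaf.stalk s) :=
        (IsLocalRing.isField_iff_maximalIdeal_eq).mpr (maximalIdeal_eq_bot_of_mem_minimalPrimes hs)
      have hFs' : IsField (S.presheaf.stalk (t.comp.base sr)) := by rw [hsr]; exact hFs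
      haveI : IsIso (t.comp.stalkMap sr) := hisot sr hsr
      have hFsr : IsField (t.top.presheaf.stalk sr) :=
        MulEquiv.isField hFs' (asIso (t.comp.stalkMap sr)).commRingCatIsoToRingEquiv.symm.toMulEquiv
      rw [← hy₁eq]
      exact stalkIdeal_ker_eq_maximalIdeal_of_isField (t.pushforwardι τ) hFsr

end Summit.ResolutionOfSingularities.ResolutionOfSingularities.Theorems.SigmaMaxModificationsCorridor3.Helpers

end
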